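/-
Copyright (c) 2026. All rights reserved.
Released under Apache 2.0 license as described in the file LICENSE.
-/
import Literature.NumberTheory.ComplexMultiplication.DegenerateCMTypesElementaryAbelianTwoGroup
import HarnessLib

/-!
# CM types on an elementary abelian `2`-group at distance ONE conjugate pair from an index-`2` coset:
# the survivors are explicit and the Kubota rank is exactly `|G|/4 + 1`

Setting of the tree's `DegenerateCMTypesElementaryAbelianTwoGroup` (seat p10 g37-#3; T. Kubota [Kubota1965] §4
Lemma 2 = B. B. Gordon [Gordon1999HodgeAVSurvey] Prop. 9.4.1 on a finite commutative group `G` of EXPONENT `2`, the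
Galois group of a multiquadratic CM field): `T` a CM type w.r.t. `ρ`, `Ŝ(χ) = Σ_{t∈T} χ(t) = |T| − 2a_χ(T)` with the
SIGN COUNT `a_χ(T) = #{t ∈ T : χ(t) = −1}` of an odd character `χ` — on the field side B. Dodson's WEIGHT of the
type over the imaginary quadratic subfield `K^{ker χ}` [Dodson1984] §3.1.1 (`a_χ(T) ∈ {0, |T|}`: the type is induced
from `K^{ker χ}`, rank `2`; `a_χ(T) = |T|/2`: Weil type over it, `χ` vanishes).  THIS FILE treats the NEXT case
`a_{χ₁}(T) = 2` (or `|T| − 2`): the type differs from the coset type `ker χ₁` (or `ρ·ker χ₁`) in exactly one conjugate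
pair — in Boolean terms, a function of Hamming weight `2` up to an affine shift, e.g. `x₁x₂x₃` in three variables.

> **Theorem** (`sum_char_eq_two_mul_add`, `typeRank_eq_of_card_filter_eq_two`).  Let `a_{χ₁}(T) = 2`, the two
> elements of `T` outside `ker χ₁` being `u ≠ v`.  Then `Ŝ(χ₁) = |T| − 4`, and for every OTHER odd character
> `Ŝ(χ) = 2(χ(u) + χ(v)) ∈ {0, ±4}`, non-zero iff `χ(uv) = 1`.  Consequently the survivors are `χ₁` (when `|G| ≠ 8`)
> and the `|G|/4 − 1` odd characters `χ ≠ χ₁` with `χ(uv) = 1`, and **`rank(T) = |G|/4 + 1`** (`|G| ≠ 8`).  The same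
> holds when `a_{χ₁}(T) = |T| − 2` (`typeRank_eq_of_card_filter_eq_card_sub_two`, through the complementary type).

So such types are DEGENERATE as soon as `|G| ≥ 16` (rank `|G|/4 + 1 < |G|/2 + 1`): order `16` gives the rank-`5`
types of the tree's spectrum `{2, 5, 9}`, order `32` gives rank `9` (`typeRank_eq_nine_of_card_thirtytwo`) — the
Walsh spectrum `{12, (±4)⁷, 0⁸}` of the cubic `x₁x₂x₃` in four variables.

* §1 `two_mul_sum_char_filter_eq` (`2Σ_{χ₁ = 1} χ = |G|[χ = 1] + |G|[χ = χ₁]`: an odd `χ ≠ χ₁` vanishes on the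
  index-`2` subgroup `ker χ₁`), `four_mul_card_odd_filter_eq` (`4·#{χ odd : χ(w) = 1} = |G|` for `w ∉ {1, ρ}`).
* §2 `filter_eq_one_mem_iff` (structure: for `χ₁(x) = 1`, `x ∈ T ⟺ x ∉ {ρu, ρv}`), **`sum_char_eq_two_mul_add`**,
  `sum_char_self_eq` (`Ŝ(χ₁) = |T| − 4`), `sum_char_ne_zero_iff_apply_mul_eq_one`.
* §3 **`typeRank_eq_of_card_filter_eq_two`** (`rank(T) = |G|/4 + 1`, `|G| ≠ 8`), `typeRank_eq_nine_of_card_thirtytwo`.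
* §4 the complementary type: `isCMTypeWith_compl`, `sum_char_compl_eq_neg`, **`typeRank_compl_eq`** (`rank(G ∖ T) =
  rank(T)` on every finite commutative group), `card_filter_compl_eq`, **`typeRank_eq_of_card_filter_eq_card_sub_two`**.

HONEST SCOPE.  Elementary character sums (orthogonality) on Kubota's formula; the sources print the rank formula
(Kubota, Gordon) and the weight dictionary (Dodson); the displayed computation is this file's (it is the Walsh
spectrum of a weight-`2` Boolean function, folklore in coding theory, C. Carlet [Carlet2020] §2.3).  THEOREMS ONLY:
no definition, no named fact, no instance, no `sorry`.

## References

* [Kubota1965] T. Kubota, *On the field extension by complex multiplication*, Trans. AMS 118 (1965), §4 Lemma 2.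
* [Gordon1999HodgeAVSurvey] B. B. Gordon, *A survey of the Hodge conjecture for abelian varieties*, Prop. 9.4.1.
* [Dodson1984] B. Dodson, *The structure of Galois groups of CM-fields*, Trans. AMS 283 (1984), §3.1.1 Theorem.
* [Carlet2020] C. Carlet, *Boolean Functions for Cryptography and Coding Theory*, CUP, §2.3 (Walsh transform).

## Provenance

Lane `lit-hodgefound` (Track 2, Layer A3), seat `lit-hodgefound-p10` generation 38, row g38-#4; neighbours cited by
name, nothing restated: `DegenerateCMTypesElementaryAbelianTwoGroup` (`sum_char_eq_card_sub_two_mul`,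
`two_mul_card_filter_univ_eq`, `sum_char_eq_zero_of_even`), `CMTypeRankCharacters`
(`IsCMTypeWith.typeRank_eq_one_add_ncard_oddCharacters`), `CMTypeElementaryTwoGroupOddWeights`
(`character_apply_eq_one_or_of_mul_self`, `sum_character_eq_zero_of_ne_zero`), Mathlib `AddChar.sum_eq_ite`.
-/

open scoped BigOperators Classical

namespace Literature.NumberTheory.ComplexMultiplication

namespace CyclicCMType

namespace ExponentTwo

variable {G : Type*} [CommGroup G] [Fintype G] [DecidableEq G] {ρ : G} {T : Finset G}

/-! ## §0 Helpers -/

section Helpers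

omit [Fintype G] [DecidableEq G] in
/-- `g·g = 1` in exponent `2`. [folklore] -/
private theorem mul_self_eq_one_w (hexp : ∀ g : G, g ^ 2 = 1) (g : G) : g * g = 1 := by
  rw [← pow_two]; exact hexp g

omit [Fintype G] [DecidableEq G] in
/-- Characters of a group of exponent `2` are `±1`-valued. [cite: Kubota1965, §4 Lemma 2 (proof)] -/
private theorem char_eq_one_or_w (hexp : ∀ g : G, g ^ 2 = 1) (χ : AddChar (Additive G) ℂ) (g : G) :
    χ (Additive.ofMul g) = 1 ∨ χ (Additive.ofMul g) = -1 :=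
  character_apply_eq_one_or_of_mul_self χ (mul_self_eq_one_w hexp g)

omit [Fintype G] [DecidableEq G] in
/-- `χ(gh) = χ(g)χ(h)`. [folklore] -/
private theorem char_mul_w (χ : AddChar (Additive G) ℂ) (g h : G) :
    χ (Additive.ofMul (g * h)) = χ (Additive.ofMul g) * χ (Additive.ofMul h) := by
  rw [ofMul_mul, AddChar.map_add_eq_mul]

omit [DecidableEq G] in
/-- `Σ_{g∈G} χ(g) = |G|·[χ = 1]`. [folklore] -/
private theorem sum_char_univ_eq_ite (χ : AddChar (Additive G) ℂ) :
    ∑ g : G, χ (Additive.ofMul g) = if χ = 0 then (Fintype.card G : ℂ) else 0 := by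
  by_cases h0 : χ = 0
  · rw [if_pos h0, h0]
    simp only [AddChar.zero_apply, Finset.sum_const, Finset.card_univ, nsmul_eq_mul, mul_one]
  · rw [if_neg h0, sum_character_eq_zero_of_ne_zero h0]

omit [Fintype G] [DecidableEq G] in
/-- The character group has exponent `2`: `χ + χ = 0`. [cite: Kubota1965, §4 Lemma 2 (proof)] -/
private theorem add_self_eq_zero_w (hexp : ∀ g : G, g ^ 2 = 1) (χ : AddChar (Additive G) ℂ) : χ + χ = 0 := by
  ext a
  rw [AddChar.add_apply, AddChar.zero_apply, ← AddChar.map_add_eq_mul]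
  have ha : a + a = 0 := congrArg Additive.ofMul (mul_self_eq_one_w hexp (Additive.toMul a))
  rw [ha, AddChar.map_zero_eq_one]

omit [Fintype G] [DecidableEq G] in
/-- `ρ² = 1`. [folklore] -/
private theorem rho_mul_rho_w (h : IsCMTypeWith ρ (T : Set G)) : ρ * ρ = 1 := by
  have := h.invol (1 : G)
  simpa [smul_eq_mul] using this

omit [Fintype G] [DecidableEq G] in
/-- `ρ ≠ 1`. [folklore] -/
private theorem rho_ne_one_w (h : IsCMTypeWith ρ (T : Set G)) : ρ ≠ 1 := by
  intro hρ
  have := h.rho_smul_ne (1 : G)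
  rw [hρ, smul_eq_mul, one_mul] at this
  exact this rfl

omit [Fintype G] [DecidableEq G] in
/-- `ρx ∈ T ⟺ x ∉ T`. [folklore] -/
private theorem rho_mul_mem_iff_w (h : IsCMTypeWith ρ (T : Set G)) (x : G) : ρ * x ∈ T ↔ x ∉ T := by
  have := h.rho_smul_mem_iff x
  simpa only [smul_eq_mul, Finset.mem_coe] using this

/-- `2|T| = |G|`. [folklore] -/
private theorem two_mul_card_w (h : IsCMTypeWith ρ (T : Set G)) : 2 * T.card = Fintype.card G := by
  have hinj : Function.Injective fun s : G => ρ * s := fun a b hab => mul_left_cancel hab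
  have hc : Tᶜ = T.image fun s => ρ * s := by
    ext x
    rw [Finset.mem_compl, Finset.mem_image]
    constructor
    · intro hx
      refine ⟨ρ * x, (rho_mul_mem_iff_w h x).2 hx, ?_⟩
      show ρ * (ρ * x) = x
      rw [← mul_assoc, rho_mul_rho_w h, one_mul]
    · rintro ⟨s, hs, rfl⟩
      exact fun hx => ((rho_mul_mem_iff_w h s).1 hx) hs
  have h1 : Tᶜ.card = T.card := by rw [hc, Finset.card_image_of_injective _ hinj]
  have h2 := Finset.card_add_card_compl T
  omega

omit [DecidableEq G] in
/-- The set of surviving odd characters as a finset. [cite: Kubota1965, §4 Lemma 2] -/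
private theorem ncard_survivors_eq_w (T : Finset G) (ρ : G) :
    {χ : AddChar (Additive G) ℂ | χ (Additive.ofMul ρ) = -1 ∧ ∑ s ∈ T, χ (Additive.ofMul s) ≠ 0}.ncard =
      ((Finset.univ.filter fun χ : AddChar (Additive G) ℂ => χ (Additive.ofMul ρ) = -1).filter
        fun χ => ∑ s ∈ T, χ (Additive.ofMul s) ≠ 0).card := by
  rw [← Set.ncard_coe_finset]
  congr 1
  ext χ
  simp only [Set.mem_setOf_eq, Finset.coe_filter, Finset.mem_filter, Finset.mem_univ, true_and]

end Helpers

/-! ## §1 Two character counts -/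

section Counts

omit [DecidableEq G] in
/-- **`2·Σ_{χ₁(g) = 1} χ(g) = |G|·[χ = 1] + |G|·[χ = χ₁]`** in exponent `2`: `2·𝟙_{χ₁ = 1} = 1 + χ₁`, and
`Σ_G χ`, `Σ_G χχ₁` are `|G|` or `0` by orthogonality (`χχ₁ = 1 ⟺ χ = χ₁`).  In particular an odd `χ ≠ χ₁` VANISHES
on the index-`2` subgroup `ker χ₁`. [cite: Kubota1965, §4 Lemma 2 (proof)] -/
theorem two_mul_sum_char_filter_eq (hexp : ∀ g : G, g ^ 2 = 1) (χ₁ χ : AddChar (Additive G) ℂ) :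
    2 * ∑ g ∈ Finset.univ.filter (fun g : G => χ₁ (Additive.ofMul g) = 1), χ (Additive.ofMul g) =
      (if χ = 0 then (Fintype.card G : ℂ) else 0) + (if χ = χ₁ then (Fintype.card G : ℂ) else 0) := by
  have hkey : ∀ g : G, (1 + χ₁ (Additive.ofMul g)) * χ (Additive.ofMul g) =
      if χ₁ (Additive.ofMul g) = 1 then 2 * χ (Additive.ofMul g) else 0 := by
    intro g
    rcases char_eq_one_or_w hexp χ₁ g with h1 | h1
    · rw [h1, if_pos rfl]; ring
    · rw [h1, if_neg (by norm_num)]; ring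
  have hsum : ∑ g : G, (1 + χ₁ (Additive.ofMul g)) * χ (Additive.ofMul g) =
      2 * ∑ g ∈ Finset.univ.filter (fun g : G => χ₁ (Additive.ofMul g) = 1), χ (Additive.ofMul g) := by
    rw [Finset.sum_congr rfl fun g _ => hkey g, ← Finset.sum_filter, Finset.mul_sum]
  rw [← hsum]
  have hexpand : ∑ g : G, (1 + χ₁ (Additive.ofMul g)) * χ (Additive.ofMul g) =
      ∑ g : G, χ (Additive.ofMul g) + ∑ g : G, (χ + χ₁) (Additive.ofMul g) := by
    rw [← Finset.sum_add_distrib]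
    refine Finset.sum_congr rfl fun g _ => ?_
    rw [AddChar.add_apply]; ring
  rw [hexpand, sum_char_univ_eq_ite, sum_char_univ_eq_ite]
  have hiff : χ + χ₁ = 0 ↔ χ = χ₁ := by
    constructor
    · intro h0
      have h11 := add_self_eq_zero_w hexp χ₁
      have : χ + χ₁ = χ₁ + χ₁ := by rw [h0, h11]
      exact add_right_cancel this
    · intro h0; rw [h0, add_self_eq_zero_w hexp χ₁]
  simp only [hiff]

omit [DecidableEq G] in
/-- An odd character `χ ≠ χ₁` vanishes on `{χ₁ = 1}`. [cite: Kubota1965, §4 Lemma 2 (proof)] -/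
theorem sum_char_filter_eq_zero (hexp : ∀ g : G, g ^ 2 = 1) {χ₁ χ : AddChar (Additive G) ℂ} (hχ0 : χ ≠ 0)
    (hne : χ ≠ χ₁) : ∑ g ∈ Finset.univ.filter (fun g : G => χ₁ (Additive.ofMul g) = 1), χ (Additive.ofMul g) = 0 := by
  have h := two_mul_sum_char_filter_eq hexp χ₁ χ
  rw [if_neg hχ0, if_neg hne, add_zero] at h
  have : (2 : ℂ) ≠ 0 := two_ne_zero
  exact (mul_eq_zero.1 h).resolve_left this

/-- **`4·#{χ : χ(ρ) = −1, χ(w) = 1} = |G|`** for `w ∉ {1, ρ}` (expand `Σ_χ (1 − χ(ρ))(1 + χ(w))` by orthogonality: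
`ρ, w, ρw ≠ 1`). [cite: Kubota1965, §4 Lemma 2 (proof)] -/
theorem four_mul_card_odd_filter_eq (hexp : ∀ g : G, g ^ 2 = 1) (hρ : ρ ≠ 1) {w : G} (hw1 : w ≠ 1) (hwρ : w ≠ ρ) :
    4 * ((Finset.univ.filter fun χ : AddChar (Additive G) ℂ => χ (Additive.ofMul ρ) = -1).filter
      fun χ => χ (Additive.ofMul w) = 1).card = Fintype.card G := by
  have hsumχ : ∀ x : G, ∑ χ : AddChar (Additive G) ℂ, χ (Additive.ofMul x) =
      if x = 1 then (Fintype.card G : ℂ) else 0 := by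
    intro x
    have h := AddChar.sum_apply_eq_ite (α := Additive G) (Additive.ofMul x)
    have hc : Fintype.card (Additive G) = Fintype.card G := Fintype.card_congr Additive.toMul
    rw [h, hc]
    rfl
  have hkey : ∀ χ : AddChar (Additive G) ℂ, (1 - χ (Additive.ofMul ρ)) * (1 + χ (Additive.ofMul w)) =
      if χ (Additive.ofMul ρ) = -1 ∧ χ (Additive.ofMul w) = 1 then 4 else 0 := by
    intro χ
    rcases char_eq_one_or_w hexp χ ρ with h1 | h1 <;> rcases char_eq_one_or_w hexp χ w with h2 | h2 <;>
      simp only [h1, h2] <;> norm_num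
  have hsum : ∑ χ : AddChar (Additive G) ℂ, (1 - χ (Additive.ofMul ρ)) * (1 + χ (Additive.ofMul w)) =
      4 * ((Finset.univ.filter fun χ : AddChar (Additive G) ℂ => χ (Additive.ofMul ρ) = -1).filter
        fun χ => χ (Additive.ofMul w) = 1).card := by
    rw [Finset.sum_congr rfl fun χ _ => hkey χ, ← Finset.sum_filter, Finset.sum_const, nsmul_eq_mul, mul_comm,
      Finset.filter_filter]
  have hexpand : ∑ χ : AddChar (Additive G) ℂ, (1 - χ (Additive.ofMul ρ)) * (1 + χ (Additive.ofMul w)) =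
      ∑ χ : AddChar (Additive G) ℂ, (1 : ℂ) - ∑ χ : AddChar (Additive G) ℂ, χ (Additive.ofMul ρ) +
        ∑ χ : AddChar (Additive G) ℂ, χ (Additive.ofMul w) - ∑ χ : AddChar (Additive G) ℂ, χ (Additive.ofMul (ρ * w)) := by
    rw [← Finset.sum_sub_distrib, ← Finset.sum_add_distrib, ← Finset.sum_sub_distrib]
    refine Finset.sum_congr rfl fun χ _ => ?_
    rw [char_mul_w]; ring
  have hρw : ρ * w ≠ 1 := by
    intro h1
    apply hwρ
    have := congrArg (fun u => ρ * u) h1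
    simp only [← mul_assoc, mul_self_eq_one_w hexp ρ, one_mul, mul_one] at this
    exact this
  rw [hexpand, hsumχ, hsumχ, hsumχ, if_neg hρ, if_neg hw1, if_neg hρw, Finset.sum_const, Finset.card_univ,
    nsmul_eq_mul, mul_one] at hsum
  have hcard : (Fintype.card (AddChar (Additive G) ℂ) : ℂ) = Fintype.card G := by
    rw [AddChar.card_eq, Fintype.card_congr Additive.toMul]
  rw [hcard] at hsum
  have : ((Fintype.card G : ℕ) : ℂ) = ((4 * ((Finset.univ.filter fun χ : AddChar (Additive G) ℂ =>
      χ (Additive.ofMul ρ) = -1).filter fun χ => χ (Additive.ofMul w) = 1).card : ℕ) : ℂ) := by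
    push_cast
    linear_combination hsum
  exact (Nat.cast_injective this).symm

end Counts

/-! ## §2 The structure of a type with `a_{χ₁}(T) = 2` and its character sums -/

section Structure

variable {χ₁ : AddChar (Additive G) ℂ} {u v : G}

omit [Fintype G] in
/-- **Structure**: if the elements of `T` with `χ₁ = −1` are exactly `u, v`, then for `χ₁(x) = 1`:
`x ∈ T ⟺ x ≠ ρu ∧ x ≠ ρv` (`x ∉ T ⟺ ρx ∈ T ⟺ ρx ∈ {u, v}`). [cite: Dodson1984, §3.1.1 Theorem] -/
theorem filter_eq_one_mem_iff (h : IsCMTypeWith ρ (T : Set G))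
    (hχ₁ : χ₁ (Additive.ofMul ρ) = -1) (hT : T.filter (fun s => χ₁ (Additive.ofMul s) = -1) = {u, v})
    {x : G} (hx : χ₁ (Additive.ofMul x) = 1) : x ∈ T ↔ x ≠ ρ * u ∧ x ≠ ρ * v := by
  have hρ2 := rho_mul_rho_w h
  have hρx : χ₁ (Additive.ofMul (ρ * x)) = -1 := by rw [char_mul_w, hχ₁, hx]; norm_num
  have key : x ∉ T ↔ ρ * x ∈ ({u, v} : Finset G) := by
    rw [← rho_mul_mem_iff_w h x, ← hT, Finset.mem_filter]
    exact ⟨fun hh => ⟨hh, hρx⟩, fun hh => hh.1⟩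
  have hsolve : ∀ y : G, ρ * x = y ↔ x = ρ * y := by
    intro y
    constructor
    · intro h1; rw [← h1, ← mul_assoc, hρ2, one_mul]
    · intro h1; rw [h1, ← mul_assoc, hρ2, one_mul]
  rw [Finset.mem_insert, Finset.mem_singleton, hsolve, hsolve] at key
  tauto

/-- **`Ŝ(χ) = 2(χ(u) + χ(v))` for every odd `χ ≠ χ₁`** when `T ∖ ker χ₁ = {u, v}` (`u ≠ v`):
`Ŝ(χ) = Σ_{ker χ₁} χ − χ(ρu) − χ(ρv) + χ(u) + χ(v)` and `Σ_{ker χ₁} χ = 0`, `χ(ρu) = −χ(u)`.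
[cite: Kubota1965, §4 Lemma 2] [cite: Dodson1984, §3.1.1 Theorem] -/
theorem sum_char_eq_two_mul_add (hexp : ∀ g : G, g ^ 2 = 1) (h : IsCMTypeWith ρ (T : Set G))
    (hχ₁ : χ₁ (Additive.ofMul ρ) = -1) (hT : T.filter (fun s => χ₁ (Additive.ofMul s) = -1) = {u, v})
    (huv : u ≠ v) {χ : AddChar (Additive G) ℂ} (hχ : χ (Additive.ofMul ρ) = -1) (hne : χ ≠ χ₁) :
    ∑ s ∈ T, χ (Additive.ofMul s) = 2 * (χ (Additive.ofMul u) + χ (Additive.ofMul v)) := by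
  have hρ2 := rho_mul_rho_w h
  have hu : u ∈ T ∧ χ₁ (Additive.ofMul u) = -1 := by
    have : u ∈ T.filter (fun s => χ₁ (Additive.ofMul s) = -1) := by rw [hT]; simp
    exact Finset.mem_filter.1 this
  have hv : v ∈ T ∧ χ₁ (Additive.ofMul v) = -1 := by
    have : v ∈ T.filter (fun s => χ₁ (Additive.ofMul s) = -1) := by rw [hT]; simp
    exact Finset.mem_filter.1 this
  -- split `T` along `χ₁ = ±1`
  have hsplit := (Finset.sum_filter_add_sum_filter_not T (fun s => χ₁ (Additive.ofMul s) = 1)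
    (fun s => χ (Additive.ofMul s))).symm
  have hnot : T.filter (fun s => ¬ χ₁ (Additive.ofMul s) = 1) = {u, v} := by
    rw [← hT]
    refine Finset.filter_congr fun s _ => ?_
    rcases char_eq_one_or_w hexp χ₁ s with h1 | h1
    · rw [h1]; norm_num
    · rw [h1]; norm_num
  -- the `χ₁ = 1` part of `T` is `ker χ₁` minus `ρu, ρv`
  set H := Finset.univ.filter (fun g : G => χ₁ (Additive.ofMul g) = 1) with hH
  have hρu : ρ * u ∈ H := by
    rw [hH, Finset.mem_filter, char_mul_w, hχ₁, hu.2]; exact ⟨Finset.mem_univ _, by norm_num⟩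
  have hρv : ρ * v ∈ (H.erase (ρ * u)) := by
    refine Finset.mem_erase.2 ⟨fun h1 => huv (mul_left_cancel h1).symm, ?_⟩
    rw [hH, Finset.mem_filter, char_mul_w, hχ₁, hv.2]; exact ⟨Finset.mem_univ _, by norm_num⟩
  have hpart : T.filter (fun s => χ₁ (Additive.ofMul s) = 1) = (H.erase (ρ * u)).erase (ρ * v) := by
    ext x
    rw [Finset.mem_filter, Finset.mem_erase, Finset.mem_erase, hH, Finset.mem_filter]
    constructor
    · rintro ⟨hxT, hx1⟩
      have hh := (filter_eq_one_mem_iff h hχ₁ hT hx1).1 hxT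
      exact ⟨hh.2, hh.1, Finset.mem_univ _, hx1⟩
    · rintro ⟨hxv, hxu, -, hx1⟩
      exact ⟨(filter_eq_one_mem_iff h hχ₁ hT hx1).2 ⟨hxu, hxv⟩, hx1⟩
  have hχ0 : χ ≠ 0 := fun h0 => by rw [h0, AddChar.zero_apply] at hχ; norm_num at hχ
  have hHsum : ∑ g ∈ H, χ (Additive.ofMul g) = 0 := sum_char_filter_eq_zero hexp hχ0 hne
  have hsum1 : ∑ s ∈ T.filter (fun s => χ₁ (Additive.ofMul s) = 1), χ (Additive.ofMul s) =
      -χ (Additive.ofMul (ρ * u)) - χ (Additive.ofMul (ρ * v)) := by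
    rw [hpart]
    have h1 := Finset.sum_erase_add (H.erase (ρ * u)) (fun g => χ (Additive.ofMul g)) hρv
    have h2 := Finset.sum_erase_add H (fun g => χ (Additive.ofMul g)) hρu
    rw [hHsum] at h2
    linear_combination h1 + h2
  have hsum2 : ∑ s ∈ T.filter (fun s => ¬ χ₁ (Additive.ofMul s) = 1), χ (Additive.ofMul s) =
      χ (Additive.ofMul u) + χ (Additive.ofMul v) := by
    rw [hnot, Finset.sum_pair huv]
  rw [hsplit, hsum1, hsum2, char_mul_w, char_mul_w, hχ]
  ring

omit [Fintype G] [DecidableEq G] in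
/-- **`Ŝ(χ₁) = |T| − 4`** when `a_{χ₁}(T) = 2`. [cite: Kubota1965, §4 Lemma 2] [cite: Dodson1984, §3.1.1 Theorem] -/
theorem sum_char_self_eq (hexp : ∀ g : G, g ^ 2 = 1)
    (h2 : (T.filter fun s => χ₁ (Additive.ofMul s) = -1).card = 2) :
    ∑ s ∈ T, χ₁ (Additive.ofMul s) = (T.card : ℂ) - 4 := by
  rw [sum_char_eq_card_sub_two_mul hexp χ₁ T, h2]; norm_num

/-- **Survivor criterion**: for odd `χ ≠ χ₁`, `Ŝ(χ) ≠ 0 ⟺ χ(u) = χ(v) ⟺ χ(uv) = 1`.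
[cite: Kubota1965, §4 Lemma 2] [cite: Dodson1984, §3.1.1 Theorem] -/
theorem sum_char_ne_zero_iff_apply_mul_eq_one (hexp : ∀ g : G, g ^ 2 = 1) (h : IsCMTypeWith ρ (T : Set G))
    (hχ₁ : χ₁ (Additive.ofMul ρ) = -1) (hT : T.filter (fun s => χ₁ (Additive.ofMul s) = -1) = {u, v})
    (huv : u ≠ v) {χ : AddChar (Additive G) ℂ} (hχ : χ (Additive.ofMul ρ) = -1) (hne : χ ≠ χ₁) :
    ∑ s ∈ T, χ (Additive.ofMul s) ≠ 0 ↔ χ (Additive.ofMul (u * v)) = 1 := by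
  rw [sum_char_eq_two_mul_add hexp h hχ₁ hT huv hχ hne, char_mul_w]
  rcases char_eq_one_or_w hexp χ u with h1 | h1 <;> rcases char_eq_one_or_w hexp χ v with h2 | h2 <;>
    rw [h1, h2] <;> norm_num

end Structure

/-! ## §3 The rank is `|G|/4 + 1` -/

section Rank

/-- **RANK OF A TYPE AT DISTANCE ONE CONJUGATE PAIR FROM AN INDEX-`2` SUBGROUP**: on a finite commutative group of
exponent `2` with `|G| ≠ 8`, a CM type `T` with `a_{χ₁}(T) = #{t ∈ T : χ₁(t) = −1} = 2` for some odd `χ₁` has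
`rank(T) = |G|/4 + 1` — the survivors are `χ₁` and the `|G|/4 − 1` odd `χ ≠ χ₁` with `χ(uv) = 1`.  (For `|G| = 8`
the count `2 = |T|/2` is the Weil case and the rank is `2`, tree `typeRank_eq_five_or_two_of_card_eight`.)
[cite: Kubota1965, §4 Lemma 2] [cite: Dodson1984, §3.1.1 Theorem] -/
theorem typeRank_eq_of_card_filter_eq_two (hexp : ∀ g : G, g ^ 2 = 1) (h : IsCMTypeWith ρ (T : Set G))
    (h8 : Fintype.card G ≠ 8) {χ₁ : AddChar (Additive G) ℂ} (hχ₁ : χ₁ (Additive.ofMul ρ) = -1)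
    (h2 : (T.filter fun s => χ₁ (Additive.ofMul s) = -1).card = 2) :
    typeRank G (T : Set G) = Fintype.card G / 4 + 1 := by
  obtain ⟨u, v, huv, hT⟩ := Finset.card_eq_two.1 h2
  have hρ2 := rho_mul_rho_w h
  have hu : u ∈ T ∧ χ₁ (Additive.ofMul u) = -1 := by
    have : u ∈ T.filter (fun s => χ₁ (Additive.ofMul s) = -1) := by rw [hT]; simp
    exact Finset.mem_filter.1 this
  have hv : v ∈ T ∧ χ₁ (Additive.ofMul v) = -1 := by
    have : v ∈ T.filter (fun s => χ₁ (Additive.ofMul s) = -1) := by rw [hT]; simp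
    exact Finset.mem_filter.1 this
  -- `w = uv ∉ {1, ρ}`
  have hw1 : u * v ≠ 1 := by
    intro h1
    apply huv
    have := congrArg (fun z => z * v) h1
    simp only [mul_assoc, mul_self_eq_one_w hexp v, mul_one, one_mul] at this
    exact this
  have hwρ : u * v ≠ ρ := by
    intro h1
    have hv' : v = ρ * u := by
      have := congrArg (fun z => u * z) h1
      simp only [← mul_assoc, mul_self_eq_one_w hexp u, one_mul] at this
      rw [this, mul_comm]
    have := (rho_mul_mem_iff_w h u).1 (hv' ▸ hv.1)
    exact this hu.1
  have hχ₁w : χ₁ (Additive.ofMul (u * v)) = 1 := by rw [char_mul_w, hu.2, hv.2]; norm_num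
  -- the survivor set
  set O := Finset.univ.filter (fun χ : AddChar (Additive G) ℂ => χ (Additive.ofMul ρ) = -1) with hO
  set surv := O.filter (fun χ => ∑ s ∈ T, χ (Additive.ofMul s) ≠ 0) with hsurv
  set W := O.filter (fun χ => χ (Additive.ofMul (u * v)) = 1) with hW
  have hT4 : T.card ≠ 4 := by have := two_mul_card_w h; omega
  have hχ₁S : ∑ s ∈ T, χ₁ (Additive.ofMul s) ≠ 0 := by
    rw [sum_char_self_eq hexp h2]
    intro h0
    have : (T.card : ℂ) = 4 := by linear_combination h0
    exact hT4 (by exact_mod_cast this)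
  have hsurvW : surv = W := by
    ext χ
    simp only [hsurv, hW, Finset.mem_filter]
    constructor
    · rintro ⟨hχO, hS⟩
      refine ⟨hχO, ?_⟩
      by_cases hne : χ = χ₁
      · rw [hne]; exact hχ₁w
      · exact (sum_char_ne_zero_iff_apply_mul_eq_one hexp h hχ₁ hT huv (Finset.mem_filter.1 hχO).2 hne).1 hS
    · rintro ⟨hχO, hχw⟩
      refine ⟨hχO, ?_⟩
      by_cases hne : χ = χ₁
      · rw [hne]; exact hχ₁S
      · exact (sum_char_ne_zero_iff_apply_mul_eq_one hexp h hχ₁ hT huv (Finset.mem_filter.1 hχO).2 hne).2 hχw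
  have hWcard : 4 * W.card = Fintype.card G := four_mul_card_odd_filter_eq hexp (rho_ne_one_w h) hw1 hwρ
  have hrank := h.typeRank_eq_one_add_ncard_oddCharacters
  rw [ncard_survivors_eq_w, ← hO, ← hsurv, hsurvW] at hrank
  omega

/-- **Order `32`**: on a group of exponent `2` and order `32` (a multiquadratic CM field of degree `32`), a CM type
with some `a_{χ₁}(T) = 2` has rank `9` (`< 17`: degenerate) — the Walsh class of the cubic `x₁x₂x₃` in four
variables. [cite: Kubota1965, §4 Lemma 2] [cite: Dodson1984, §3.1.1 Theorem] -/
theorem typeRank_eq_nine_of_card_thirtytwo (hexp : ∀ g : G, g ^ 2 = 1) (h : IsCMTypeWith ρ (T : Set G))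
    (h32 : Fintype.card G = 32) {χ₁ : AddChar (Additive G) ℂ} (hχ₁ : χ₁ (Additive.ofMul ρ) = -1)
    (h2 : (T.filter fun s => χ₁ (Additive.ofMul s) = -1).card = 2) : typeRank G (T : Set G) = 9 := by
  rw [typeRank_eq_of_card_filter_eq_two hexp h (by rw [h32]; norm_num) hχ₁ h2, h32]

/-- **Order `16`** (consistency with the tree's spectrum `{2, 5, 9}`): `a_{χ₁}(T) = 2 ⟹ rank(T) = 5`.
[cite: Kubota1965, §4 Lemma 2] [cite: Dodson1984, §3.1.1 Theorem] -/
theorem typeRank_eq_five_of_card_sixteen (hexp : ∀ g : G, g ^ 2 = 1) (h : IsCMTypeWith ρ (T : Set G))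
    (h16 : Fintype.card G = 16) {χ₁ : AddChar (Additive G) ℂ} (hχ₁ : χ₁ (Additive.ofMul ρ) = -1)
    (h2 : (T.filter fun s => χ₁ (Additive.ofMul s) = -1).card = 2) : typeRank G (T : Set G) = 5 := by
  rw [typeRank_eq_of_card_filter_eq_two hexp h (by rw [h16]; norm_num) hχ₁ h2, h16]

end Rank

/-! ## §4 The complementary type and the case `a_{χ₁}(T) = |T| − 2` -/

section Complement

/-- **The complement `G ∖ T = ρT` of a CM type is a CM type.** [cite: Kubota1965, §2] -/
theorem isCMTypeWith_compl (h : IsCMTypeWith ρ (T : Set G)) : IsCMTypeWith ρ ((Tᶜ : Finset G) : Set G) := by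
  refine ⟨fun y => ?_, h.comm, h.invol⟩
  rw [Finset.coe_compl, Set.mem_compl_iff, Set.mem_compl_iff, not_not, h.rho_smul_mem_iff]

/-- **`Ŝ_{G∖T}(χ) = −Ŝ_T(χ)` for `χ ≠ 1`** (`Σ_G χ = 0`). [cite: Kubota1965, §4 Lemma 2 (proof)] -/
theorem sum_char_compl_eq_neg {χ : AddChar (Additive G) ℂ} (hχ : χ ≠ 0) (T : Finset G) :
    ∑ s ∈ Tᶜ, χ (Additive.ofMul s) = -∑ s ∈ T, χ (Additive.ofMul s) := by
  have htot : ∑ g : G, χ (Additive.ofMul g) = 0 := sum_character_eq_zero_of_ne_zero hχ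
  rw [← Finset.sum_add_sum_compl T] at htot
  linear_combination htot

/-- **`rank(G ∖ T) = rank(T)`** for a CM type on ANY finite commutative group: the complement has the opposite odd
character sums, hence the same survivors (Kubota). [cite: Kubota1965, §4 Lemma 2] -/
theorem typeRank_compl_eq (h : IsCMTypeWith ρ (T : Set G)) :
    typeRank G ((Tᶜ : Finset G) : Set G) = typeRank G (T : Set G) := by
  rw [(isCMTypeWith_compl h).typeRank_eq_one_add_ncard_oddCharacters, h.typeRank_eq_one_add_ncard_oddCharacters]
  congr 2
  ext χ
  simp only [Set.mem_setOf_eq]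
  constructor
  · rintro ⟨hχ, hS⟩
    have hχ0 : χ ≠ 0 := fun h0 => by rw [h0, AddChar.zero_apply] at hχ; norm_num at hχ
    rw [sum_char_compl_eq_neg hχ0] at hS
    exact ⟨hχ, fun h0 => hS (by rw [h0, neg_zero])⟩
  · rintro ⟨hχ, hS⟩
    have hχ0 : χ ≠ 0 := fun h0 => by rw [h0, AddChar.zero_apply] at hχ; norm_num at hχ
    rw [sum_char_compl_eq_neg hχ0]
    exact ⟨hχ, neg_ne_zero.2 hS⟩

/-- **`a_χ(G ∖ T) = |G|/2 − a_χ(T)`** for `χ ≠ 1` in exponent `2` (`χ = −1` on exactly `|G|/2` elements).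
[cite: Kubota1965, §4 Lemma 2] -/
theorem card_filter_compl_add_eq (hexp : ∀ g : G, g ^ 2 = 1) {χ : AddChar (Additive G) ℂ} (hχ : χ ≠ 0)
    (T : Finset G) :
    (Tᶜ.filter fun s => χ (Additive.ofMul s) = -1).card + (T.filter fun s => χ (Additive.ofMul s) = -1).card =
      Fintype.card G / 2 := by
  have h1 := two_mul_card_filter_univ_eq hexp hχ
  have hsplit : (T.filter fun s => χ (Additive.ofMul s) = -1).card +
      (Tᶜ.filter fun s => χ (Additive.ofMul s) = -1).card =
      (Finset.univ.filter fun g : G => χ (Additive.ofMul g) = -1).card := by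
    rw [← Finset.card_union_of_disjoint (Finset.disjoint_filter_filter disjoint_compl_right),
      ← Finset.filter_union, Finset.union_compl]
  omega

/-- **The case `a_{χ₁}(T) = |T| − 2`** (the type differs from `ρ·ker χ₁` in one conjugate pair): `rank(T) = |G|/4 + 1`
(`|G| ≠ 8`), through the complementary type, which has `a_{χ₁} = 2` and the same rank.
[cite: Kubota1965, §4 Lemma 2] [cite: Dodson1984, §3.1.1 Theorem] -/
theorem typeRank_eq_of_card_filter_eq_card_sub_two (hexp : ∀ g : G, g ^ 2 = 1) (h : IsCMTypeWith ρ (T : Set G))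
    (h8 : Fintype.card G ≠ 8) {χ₁ : AddChar (Additive G) ℂ} (hχ₁ : χ₁ (Additive.ofMul ρ) = -1)
    (h2 : (T.filter fun s => χ₁ (Additive.ofMul s) = -1).card + 2 = T.card) :
    typeRank G (T : Set G) = Fintype.card G / 4 + 1 := by
  have hχ0 : χ₁ ≠ 0 := fun h0 => by rw [h0, AddChar.zero_apply] at hχ₁; norm_num at hχ₁
  have hc := card_filter_compl_add_eq hexp hχ0 T
  have hT := two_mul_card_w h
  have h2' : (Tᶜ.filter fun s => χ₁ (Additive.ofMul s) = -1).card = 2 := by omega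
  rw [← typeRank_compl_eq h]
  exact typeRank_eq_of_card_filter_eq_two hexp (isCMTypeWith_compl h) h8 hχ₁ h2'

/-- **Summary in terms of the sign count alone**: `a_{χ₁}(T) ∈ {2, |T| − 2}` ⟹ `rank(T) = |G|/4 + 1` (`|G| ≠ 8`).
[cite: Kubota1965, §4 Lemma 2] [cite: Dodson1984, §3.1.1 Theorem] -/
theorem typeRank_eq_of_card_filter_mem (hexp : ∀ g : G, g ^ 2 = 1) (h : IsCMTypeWith ρ (T : Set G))
    (h8 : Fintype.card G ≠ 8) {χ₁ : AddChar (Additive G) ℂ} (hχ₁ : χ₁ (Additive.ofMul ρ) = -1)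
    (h2 : (T.filter fun s => χ₁ (Additive.ofMul s) = -1).card = 2 ∨
      (T.filter fun s => χ₁ (Additive.ofMul s) = -1).card + 2 = T.card) :
    typeRank G (T : Set G) = Fintype.card G / 4 + 1 := by
  rcases h2 with h2 | h2
  · exact typeRank_eq_of_card_filter_eq_two hexp h h8 hχ₁ h2
  · exact typeRank_eq_of_card_filter_eq_card_sub_two hexp h h8 hχ₁ h2

end Complement

end ExponentTwo

end CyclicCMType

end Literature.NumberTheory.ComplexMultiplication
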